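import Mathlib
import Summits.Ventures.HodgeRepro.Tier4.Line1.RTFSetting
import Summits.Ventures.HodgeRepro.Tier4.Line1.RtfUnfold
import Summits.Ventures.HodgeRepro.Tier4.Line1.RtfSpectralStep
import Summits.Ventures.HodgeRepro.Tier4.Line1.KernelSupportFinite
import Summits.Ventures.HodgeRepro.Tier4.Line1.KernelUnfold
import Summits.Ventures.HodgeRepro.Tier4.Line1.KernelOperator
import Summits.Ventures.HodgeRepro.Tier4.Line1.KernelOpEqR
import Summits.Ventures.HodgeRepro.Tier4.Line1.KernelEigen
import Summits.Ventures.HodgeRepro.Tier4.Line1.KernelCompact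
import Summits.Ventures.HodgeRepro.Tier4.Line1.InnerCalculus
import Summits.Ventures.HodgeRepro.Tier4.Line1.KernelAdjoint
import Summits.Ventures.HodgeRepro.Tier4.Line1.RelClosed
import Summits.Ventures.HodgeRepro.Tier4.Line1.RelClosedOrtho
import Summits.Ventures.HodgeRepro.Tier4.Line1.IrreducibleMinimal

/-!
# Tier4/Line1/IrreducibleSubspace — LINE L1, J1-(4b) `exists_irreducible_invariant_subspace` MODULO rung (4a)

Blind re-derivation cell `pub-hodge-repro`, Tier 4 «prove the step» (README §9–§10), seat t4-L1-p4 (prover, gen 0;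
J1-(4b) `exists_irreducible_invariant_subspace` (Skeleton v0.16 L444, the declared wall) as census + rungs, S12549;
after `InnerCalculus` and `KernelAdjoint`).  Generic Part I over every `RTF.Setting G`, `[SecondCountableTopology G]`
where the `L²(DG)` Hilbert-space arguments need it; Mathlib + the landed L1 layer only.  Paper: proofs/t4/L1/J1-4b.md.

This module (4 of 4): `relClosed_self`, `toLp_mem_eigenspace`, and
`exists_irreducible_invariant_subspace_of_nondegenerate` = the statement of J1-(4b) (Skeleton v0.16 L444–L451,
conclusion byte-identical) with rung (4a) `kernelOp_nondegenerate` as the DISPLAYED hypothesis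
`h4a : ∀ ψ : Lp ℂ 2 (S.μ.restrict S.DG), ψ ≠ 0 → ∃ f, IsTest f ∧ ¬ (S.kernelOp f ψ =ᵐ[S.μ.restrict S.DG] 0)`
(t4-L1-p1's rung; its statement needs `[LocallyCompactSpace G]`, which (4b) as typed does not carry — the verbatim
(4b) is the composition `exists_irreducible_invariant_subspace_of_nondegenerate V hV hclosed hne (S.kernelOp_nondegenerate)`
once (4a) lands, under `[LocallyCompactSpace G]`).  Proof: R-D `exists_eigen_mem` (KernelAdjoint) gives `f`, `μ ≠ 0`
and an eigenfunction in `V`; `Nat.find` the least `dim (E ⊓ cls U)` over relatively closed invariant `U` with non-zero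
trace; `U* :=` the intersection of all relatively closed invariant subspaces with that trace; R-E
`irreducible_of_minimal`.  Fields of the Setting used: `haar`, `rightInv`, `fdG`, `compG`, `discrete`, `closed`.

Nothing here says anything about the status of the Hodge conjecture for CM abelian varieties, which is NOT proved;
HC_CM is NOT proved by anyone in this repository.
-/

set_option autoImplicit false

noncomputable section

namespace Summit.Ventures.HodgeRepro.Tier4.Line1

open MeasureTheory Topology Filter Set
open scoped Uniformity Pointwise InnerProductSpace ComplexConjugate

namespace RTF

variable {G : Type} [Group G] [TopologicalSpace G] [IsTopologicalGroup G] [MeasurableSpace G]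
  [BorelSpace G]

namespace Setting

variable (S : Setting G)


omit [IsTopologicalGroup G] [BorelSpace G] in
/-- `V` itself is a relatively closed invariant subspace of `V` under the closedness clause of (4b). -/
theorem relClosed_self {V : Set (G → ℂ)} (hV : S.IsInvariantSubspace V)
    (hclosed : ∀ ψ : G → ℂ, Continuous ψ → S.Invariant ψ →
      (∀ ε : ℝ, 0 < ε → ∃ ψ' ∈ V,
        eLpNorm (fun x => ψ x - ψ' x) 2 (S.μ.restrict S.DG) < ENNReal.ofReal ε) → ψ ∈ V)
    (hne : V.Nonempty) : S.RelClosed V V := by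
  obtain ⟨ψ, hψ⟩ := hne
  refine ⟨subset_rfl, hV, ?_, hclosed⟩
  have := hV.smul ψ hψ 0
  simpa using this

/-- the class of an eigenfunction `R(f*)(R(f)ψ) = μ ψ` lies in the eigenspace of `T_{f*} ∘ T_f`. -/
theorem toLp_mem_eigenspace [SecondCountableTopology G] {f : G → ℂ} (hf : IsTest f)
    (T₁ T₂ : Lp ℂ 2 (S.μ.restrict S.DG) →L[ℂ] Lp ℂ 2 (S.μ.restrict S.DG))
    (hT₁ : ∀ ψ : Lp ℂ 2 (S.μ.restrict S.DG), ⇑(T₁ ψ) =ᵐ[S.μ.restrict S.DG] S.kernelOp (cj (refl f)) ⇑ψ)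
    (hT₂ : ∀ ψ : Lp ℂ 2 (S.μ.restrict S.DG), ⇑(T₂ ψ) =ᵐ[S.μ.restrict S.DG] S.kernelOp f ⇑ψ)
    {ψ : G → ℂ} (hψ : S.Invariant ψ) (hψc : Continuous ψ) {μ : ℂ}
    (heig : ∀ x, S.R (cj (refl f)) (S.R f ψ) x = μ * ψ x) :
    (S.memLp_two_DG hψc).toLp ψ ∈ Module.End.eigenspace ((T₁.comp T₂ : Lp ℂ 2 (S.μ.restrict S.DG) →L[ℂ]
      Lp ℂ 2 (S.μ.restrict S.DG)) : Lp ℂ 2 (S.μ.restrict S.DG) →ₗ[ℂ] Lp ℂ 2 (S.μ.restrict S.DG)) μ := by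
  rw [Module.End.mem_eigenspace_iff]
  show T₁ (T₂ ((S.memLp_two_DG hψc).toLp ψ)) = μ • (S.memLp_two_DG hψc).toLp ψ
  have hRc : Continuous (S.R f ψ) := S.continuous_R_of_invariant hf hψ hψc
  have hRinv : S.Invariant (S.R f ψ) := S.R_invariant f hψ
  have hRRc : Continuous (S.R (cj (refl f)) (S.R f ψ)) := S.continuous_R_of_invariant hf.refl.cj hRinv hRc
  rw [S.toLp_R_eq hf T₂ hT₂ hψ hψc hRc, S.toLp_R_eq hf.refl.cj T₁ hT₁ hRinv hRc hRRc]
  apply Lp.ext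
  filter_upwards [MemLp.coeFn_toLp (S.memLp_two_DG hRRc), Lp.coeFn_smul μ ((S.memLp_two_DG hψc).toLp ψ),
    MemLp.coeFn_toLp (S.memLp_two_DG hψc)] with x h1 h2 h3
  rw [h1, h2, Pi.smul_apply, smul_eq_mul, h3, heig x]

/-- J1-(4b) MODULO (4a) — `exists_irreducible_invariant_subspace` with rung (4a) as the displayed hypothesis
`h4a`: every relatively closed invariant `V` with a non-zero member contains a non-zero IRREDUCIBLE invariant
subspace.  Proof: R-D (`exists_eigen_mem`) gives `f`, `μ ≠ 0` and an eigenfunction in `V`; among the relatively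
closed invariant `U ⊆ V` with non-zero trace on the finite-dimensional eigenspace `E` of `T_{f*} ∘ T_f` pick one of
least `dim (E ⊓ cls U)` (`Nat.find`); `U* :=` the intersection of all relatively closed invariant `U'` with the
same trace is relatively closed invariant with that trace, and R-E (`irreducible_of_minimal`) makes it
irreducible (Deitmar–Echterhoff 9.2.7 (iv)). -/
theorem exists_irreducible_invariant_subspace_of_nondegenerate [SecondCountableTopology G]
    (V : Set (G → ℂ)) (hV : S.IsInvariantSubspace V)
    (hclosed : ∀ ψ : G → ℂ, Continuous ψ → S.Invariant ψ →
      (∀ ε : ℝ, 0 < ε → ∃ ψ' ∈ V,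
        eLpNorm (fun x => ψ x - ψ' x) 2 (S.μ.restrict S.DG) < ENNReal.ofReal ε) → ψ ∈ V)
    (hne : ∃ ψ ∈ V, ∃ x, ψ x ≠ 0)
    (h4a : ∀ ψ : Lp ℂ 2 (S.μ.restrict S.DG), ψ ≠ 0 →
      ∃ f : G → ℂ, IsTest f ∧ ¬ (S.kernelOp f ψ =ᵐ[S.μ.restrict S.DG] 0)) :
    ∃ V' : Set (G → ℂ), S.IsInvariantSubspace V' ∧ V' ⊆ V ∧ S.IsIrreducible V' ∧
      ∃ ψ ∈ V', ∃ x, ψ x ≠ 0 := by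
  haveI := S.haar
  haveI : Countable S.Gk := S.countable_Gk
  -- R-D: the eigenfunction
  obtain ⟨f, hf, μ, hμ, ψe, hψeV, hψex, heig⟩ := S.exists_eigen_mem V hV hclosed hne h4a
  obtain ⟨T₂, hT₂⟩ := S.exists_kernelCLM hf
  obtain ⟨T₁, hT₁⟩ := S.exists_kernelCLM hf.refl.cj
  set T := T₁.comp T₂ with hTdef
  set EH := Module.End.eigenspace (T : Lp ℂ 2 (S.μ.restrict S.DG) →ₗ[ℂ] Lp ℂ 2 (S.μ.restrict S.DG)) μ
    with hEH
  have hTc : IsCompactOperator T := S.kernelCLM_comp_isCompactOperator hf T₁ T₂ hT₂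
  haveI hEHfin : FiniteDimensional ℂ EH := ContinuousLinearMap.finite_dimensional_eigenspace hTc μ hμ
  have hfin : ∀ (U' : Set (G → ℂ)) (hU' : S.RelClosed V U'),
      FiniteDimensional ℂ ((EH ⊓ S.cls hU' : Submodule ℂ (Lp ℂ 2 (S.μ.restrict S.DG)))) :=
    fun U' hU' => Submodule.finiteDimensional_of_le inf_le_left
  -- `V` has non-zero trace
  have hV0 : S.RelClosed V V := S.relClosed_self hV hclosed ⟨ψe, hψeV⟩
  have hψec := hV.cont ψe hψeV
  have hψeinv := hV.inv ψe hψeV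
  have hue : (S.memLp_two_DG hψec).toLp ψe ∈ EH ⊓ S.cls hV0 :=
    ⟨S.toLp_mem_eigenspace hf T₁ T₂ hT₁ hT₂ hψeinv hψec heig, S.toLp_mem_cls hV0 hψeV⟩
  have hue0 : (S.memLp_two_DG hψec).toLp ψe ≠ 0 := by
    intro h0
    have h1 : ψe =ᵐ[S.μ.restrict S.DG] (0 : G → ℂ) :=
      (MemLp.coeFn_toLp (S.memLp_two_DG hψec)).symm.trans (Lp.eq_zero_iff_ae_eq_zero.mp h0)
    have := S.eq_of_ae_eq_DG hψeinv hψec (fun _ _ => rfl) continuous_const h1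
    obtain ⟨x, hx⟩ := hψex
    exact hx (by rw [this]; rfl)
  have hVne : EH ⊓ S.cls hV0 ≠ ⊥ := (Submodule.ne_bot_iff _).mpr ⟨_, hue, hue0⟩
  -- the minimal dimension
  set P : ℕ → Prop := fun n => ∃ (U : Set (G → ℂ)) (hU : S.RelClosed V U), EH ⊓ S.cls hU ≠ ⊥ ∧
    Module.finrank ℂ ((EH ⊓ S.cls hU : Submodule ℂ (Lp ℂ 2 (S.μ.restrict S.DG)))) = n with hP
  have hPex : ∃ n, P n := ⟨_, V, hV0, hVne, rfl⟩
  classical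
  obtain ⟨Umin, hUmin, hUminne, hUmindim⟩ := Nat.find_spec hPex
  set n₀ := Nat.find hPex with hn₀
  have hmin : ∀ (U' : Set (G → ℂ)) (hU' : S.RelClosed V U'), EH ⊓ S.cls hU' ≠ ⊥ →
      n₀ ≤ Module.finrank ℂ ((EH ⊓ S.cls hU' : Submodule ℂ (Lp ℂ 2 (S.μ.restrict S.DG)))) :=
    fun U' hU' hne' => Nat.find_min' hPex ⟨U', hU', hne', rfl⟩
  -- `U*`
  set Ustar : Set (G → ℂ) := {ψ | ∀ (U' : Set (G → ℂ)) (hU' : S.RelClosed V U'),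
    EH ⊓ S.cls hU' = EH ⊓ S.cls hUmin → ψ ∈ U'} with hUstar
  have hUstar_sub : Ustar ⊆ Umin := fun ψ hψ => hψ Umin hUmin rfl
  have hUstarRC : S.RelClosed V Ustar := by
    refine ⟨hUstar_sub.trans hUmin.subset, ?_, fun U' hU' _ => hU'.zero_mem, ?_⟩
    · refine ⟨fun ψ hψ => hUmin.inv.inv ψ (hUstar_sub hψ), fun ψ hψ => hUmin.inv.cont ψ (hUstar_sub hψ),
        ?_, ?_, ?_, ?_⟩
      · intro ψ hψ g U' hU' htr
        exact hU'.inv.right ψ (hψ U' hU' htr) g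
      · intro ψ hψ φ hφ U' hU' htr
        exact hU'.inv.add ψ (hψ U' hU' htr) φ (hφ U' hU' htr)
      · intro ψ hψ c U' hU' htr
        exact hU'.inv.smul ψ (hψ U' hU' htr) c
      · intro ψ hψ g hg U' hU' htr
        exact hU'.inv.conv ψ (hψ U' hU' htr) g hg
    · intro ψ hψc hψinv happ U' hU' htr
      refine hU'.closed ψ hψc hψinv fun ε hε => ?_
      obtain ⟨ψ', hψ', hlt⟩ := happ ε hε
      exact ⟨ψ', hψ' U' hU' htr, hlt⟩
  -- the trace of `U*` is the trace of `U_min`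
  have htrace : EH ⊓ S.cls hUstarRC = EH ⊓ S.cls hUmin := by
    apply le_antisymm
    · exact inf_le_inf_left _ (S.cls_mono hUstarRC hUmin hUstar_sub)
    · rintro u ⟨huE, ψ, hψUmin, huψ⟩
      refine ⟨huE, ψ, ?_, huψ⟩
      intro U' hU' htr
      have hu' : u ∈ EH ⊓ S.cls hU' := by rw [htr]; exact ⟨huE, ψ, hψUmin, huψ⟩
      obtain ⟨ψ', hψ'U', huψ'⟩ := hu'.2
      have e : ψ = ψ' := S.eq_of_ae_eq_DG (hUmin.inv.inv ψ hψUmin) (hUmin.inv.cont ψ hψUmin)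
        (hU'.inv.inv ψ' hψ'U') (hU'.inv.cont ψ' hψ'U') (huψ.symm.trans huψ')
      rw [e]
      exact hψ'U'
  have hstarne : EH ⊓ S.cls hUstarRC ≠ ⊥ := by rw [htrace]; exact hUminne
  have hstardim : Module.finrank ℂ ((EH ⊓ S.cls hUstarRC : Submodule ℂ (Lp ℂ 2 (S.μ.restrict S.DG)))) =
      n₀ := by rw [htrace, hUmindim]
  -- R-E
  have hirr : S.IsIrreducible Ustar := by
    refine S.irreducible_of_minimal hf hμ T₁ T₂ hT₁ hT₂ hUstarRC hstarne ?_ ?_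
    · intro U' hU' hne'
      rw [hstardim]
      exact hmin U' hU' hne'
    · intro U' hU' htr ψ hψ
      exact hψ U' hU' (htr.trans htrace)
  -- the non-zero member
  obtain ⟨u, ⟨-, ψ, hψstar, huψ⟩, hu0⟩ := (Submodule.ne_bot_iff _).mp hstarne
  refine ⟨Ustar, hUstarRC.inv, hUstarRC.subset, hirr, ψ, hψstar, ?_⟩
  by_contra hall
  push Not at hall
  apply hu0
  rw [Lp.eq_zero_iff_ae_eq_zero]
  filter_upwards [huψ] with x hx
  rw [hx, hall x]
  rfl

end Setting

end RTF

end Summit.Ventures.HodgeRepro.Tier4.Line1
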